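import Summits.BirchSwinnertonDyer.BirchSwinnertonDyer.Theorems.PrintCf2DisegniPairTwoQuotientLawOdd
import Summits.BirchSwinnertonDyer.BirchSwinnertonDyer.Theorems.PrintCf2DisegniPairTwoCompanionValueChi8
import Literature.NumberTheory.EllipticCurves.PAdicLFunctionNeZeroProofs
import HarnessLib

/-!
# Road (C) `disegni-pair-two` on crux stmt-BirchSwinnertonDyer-20368 — the COMPANION CANCELS on the `χ₋₈∘N`-line
# (`d* = −2`): the minus-branch value at `T = −2` (`α⁻³Σ χ₋₈[·/8]⁻`) vs Birch's odd formula at `χ₋₈`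

Cell `bsd-print-cf2` (`run/shared/lean/pub/bsd-print-cf2/`), width seat `bsd-line-cf2-p1-w8` g22; third of the
companion-cancellation files (`…CompanionValueChi8`, `…CompanionValueChi4`). `--supports stmt-BirchSwinnertonDyer-20368`
(helper). THEOREMS ONLY (no `def`, no named fact, no `sorry`); conditional on every displayed hypothesis. BSD is not
proved by any of this; no summit statement is claimed; 20368 is not closed here.

## What is proved

In `quotient_law_chi8'` (member `V^{(−2)}`, line `χ₋₈∘N`) the companion `W′` (newform `f′⊗χ₋₈`) enters through
`L(W′,1)` and through the VALUE of the minus branch `L₂⁻(f′,ω,T)` at `T = −2` (the point of `χ₈`; character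
`ωχ₈ = χ₋₈`). By MTT interpolation of the minus branch (`hasSum_padicLMinusBranchCoeff_mul_pow_of_isPrimitive` at the
twin of `χ₈`, read through -w8 g21's `sum_twin_mul_teichWeight_eq_ratMinusTwistedSymbolSum` and
`ratMinusTwistedSymbolSum_twin_mul_chi4_of_level_eight`: value `= α⁻³·Σ_b χ₋₈(b)[b/8]⁻_{f′}`) and Birch's odd
formula at `χ₋₈` (`S⁻_{χ₋₈}(f′)·Ω⁻_{f′}·i = τ(χ₋₈)·L(W′,1)`), they CANCEL:

* `algebraMap_tsum_coeff_padicLFunctionMinusBranch_neg_two` — `ι₂(Σ_k [T^k]L₂⁻(f,ω)(−2)^k) = ι₂(α⁻³)·ι⁻¹(S⁻_{χ₋₈}(f))`;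
* `ratMinusTwistedSymbolSum_chi8'_mul_minusPeriod_eq` — Birch-odd for a curve with newform `f′⊗χ₋₈`;
* ★★ `quotient_law_chi8'_companion_free` — under the hypotheses of `quotient_law_chi8'`:
  `ι⁻¹(L′(W,1)·Z°·i)·h₂ = σ₀·log₂5·ι⁻¹(ĥ(P)·u·Ω⁻_f·τ(χ₋₈))·ι₂(α⁻³)·L₂⁻′(f,ω,−2)` (the sign absorbs the
  `c₀ = −u·Ω⁻Ω⁻′` of the odd file); only `L(W′,1) ≠ 0` is used.

With the two sibling files, the companion's BSD formula is NOT an input of road (C) in ANY of the three classes.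

References: B. Mazur, J. Tate, J. Teitelbaum, Invent. Math. 84 (1986) §I.8 (8.6), §I.12–I.14 [MazurTateTeitelbaum1986Invent];
D. Disegni, Compos. Math. 153 (2017) Thm. B [Disegni2017]; B. Perrin-Riou, Invent. Math. 89 (1987) §1 [PerrinRiou1987].
-/

set_option autoImplicit false
set_option linter.dupNamespace false

noncomputable section

open scoped Classical MatrixGroups ModularForm NumberField

open CongruenceSubgroup NumberField IsDedekindDomain WeierstrassCurve WeierstrassCurve.Affine.Point
  Literature.NumberTheory.EllipticCurves Literature.NumberTheory.EllipticCurves.ModularForms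
  Literature.NumberTheory.EllipticCurves.Disegni2017 Literature.NumberTheory.GaloisRepresentations
  Summit.BirchSwinnertonDyer.Rank1Residual.AdditivePotMult Summit.BirchSwinnertonDyer.Rank1Residual.Additive

namespace Summit.BirchSwinnertonDyer.BirchSwinnertonDyer.Theorems.PrintCf2.DisegniPairTwo

section CompanionMinusEight

/-! ### §1 The minus-branch value at `T = −2` as a number -/

/-- **`ι₂(Σ_k [T^k]L₂⁻(f,ω)(−2)^k) = ι₂(α⁻³)·ι⁻¹(Σ_b χ₋₈(b)[b/8]⁻_f)`** for `E = W/ℚ` globally minimal good ordinary at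
`2` with newform `f` (`α = unitRoot W 2`): the odd branch converges at `−2` (bounded coefficients) and its image in
`ℂ₂` is the MTT interpolation value of `L₂⁻(f,ω,·)` at the twin of `χ₈`, whose symbol sum is the `χ₋₈`-twisted minus
symbol sum (`χ₋₈ = χ₈·χ₄`). [cite: MazurTateTeitelbaum1986Invent, §I.13–I.14 (14.3)] -/
theorem algebraMap_tsum_coeff_padicLFunctionMinusBranch_neg_two (ι : PadicAlgCl 2 ≃+* ℂ) {W : WeierstrassCurve ℚ}
    [W.IsElliptic] [W.IsGloballyMinimal] {N : ℕ} [NeZero N] {f : CuspForm (Gamma0 N) 2} (hord : IsOrdinaryAt W 2)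
    (hf : IsNewformOf W f) :
    algebraMap ℚ_[2] ℂ_[2] (∑' k : ℕ, PowerSeries.coeff k (padicLFunctionMinusBranch f (unitRoot W 2 : ℚ_[2]) 1) *
        (-2) ^ k) =
      algebraMap ℚ_[2] ℂ_[2] ((unitRoot W 2 : ℚ_[2])⁻¹ ^ (2 + 1)) *
        ((ι.symm (ratMinusTwistedSymbolSum f
          (ZMod.χ₈'.ringHomComp (Int.castRingHom ℂ) : DirichletCharacter ℂ (2 ^ (2 + 1)))) :
            PadicAlgCl 2) : ℂ_[2]) := by
  -- the unit root and the minus Mazur–Swinnerton-Dyer measure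
  obtain ⟨hαeq, hαu, hα0⟩ := unitRoot_coe_spec (W := W) hord
  set α : ℚ_[2] := (unitRoot W 2 : ℚ_[2]) with hαdef
  have hf0 : IsNewform0 f := hf.1
  have hQ : coeffField f = ⊥ := hf.coeffField_eq_bot
  have hN : ¬ 2 ∣ N := not_dvd_level_of_isNewformOf hf hord.1
  have hapf : cuspCoeff f 2 = ((W.frobeniusTrace 2 : ℤ) : ℂ) :=
    cuspCoeff_eq_frobeniusTrace_of_isNewformOf_holds hf hord.1
  have hαeq2 : α ^ 2 - ((W.frobeniusTrace 2 : ℤ) : ℚ_[2]) * α + 2 = 0 := by exact_mod_cast hαeq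
  have hdist := fun n a ↦
    sum_fiber_msdMinusMeasure_succ_eq_of_coeffField (p := 2) hf0 hQ hN hapf hα0 hαeq n a
  obtain ⟨C', hC'⟩ := exists_norm_msdMinusMeasure_le_of_maninDrinfeld (p := 2)
    (exists_nsmul_modularSymbol_mem_periodLattice_of_isNewform0 hf0 hQ) hαu
  have hC : ∀ k, ‖PowerSeries.coeff k (padicLFunctionMinusBranch f α 1)‖ ≤ C' :=
    norm_coeff_padicLFunctionMinusBranch_le f α hdist hC' 1
  -- the even primitive character mod `8` on the MTT side: the twin of `χ₈`, point `−2`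
  have he2 : cyclotomicExponent 2 ≤ 2 := by rw [cyclotomicExponent_two]
  have h4₃ : 4 ∣ 2 ^ (2 + 1) := by norm_num
  set χ₈₃ : DirichletCharacter ℂ (2 ^ (2 + 1)) := ZMod.χ₈.ringHomComp (Int.castRingHom ℂ) with hχ₈₃
  have h8even : χ₈₃.Even := chi8_even
  have h8prim : χ₈₃.IsPrimitive := isPrimitive_χ₈_ringHomComp_of_charZero ℂ
  have hT8prim : DirichletCharacter.IsPrimitive
      ((χ₈₃⁻¹.ringHomComp ι.symm.toRingHom).ringHomComp (algebraMap (PadicAlgCl 2) ℂ_[2])) :=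
    (twin_isPrimitive_iff ι χ₈₃).mpr h8prim
  have hT8even : DirichletCharacter.Even
      ((χ₈₃⁻¹.ringHomComp ι.symm.toRingHom).ringHomComp (algebraMap (PadicAlgCl 2) ℂ_[2])) :=
    (twin_even_iff ι χ₈₃).mpr h8even
  have hT8ord : ∃ j : ℕ, orderOf
      ((χ₈₃⁻¹.ringHomComp ι.symm.toRingHom).ringHomComp (algebraMap (PadicAlgCl 2) ℂ_[2])) = 2 ^ j := by
    rw [orderOf_twin]; exact exists_orderOf_eq_two_pow χ₈₃
  have hpt8 : ((χ₈₃⁻¹.ringHomComp ι.symm.toRingHom).ringHomComp (algebraMap (PadicAlgCl 2) ℂ_[2]))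
      (cyclotomicGenerator 2 : ZMod (2 ^ (2 + 1))) - 1 = -2 := by
    rw [twin_apply_cyclotomicGenerator_sub_one ι (m := 2) χ₈₃, hχ₈₃, cycLinePoint_chi8]
  -- the interpolation value
  have hv := hasSum_padicLMinusBranchCoeff_mul_pow_of_isPrimitive f α hdist hC' 1 he2 _ hT8prim hT8even hT8ord
  simp only [← coeff_padicLFunctionMinusBranch] at hv
  rw [sum_twin_mul_teichWeight_eq_ratMinusTwistedSymbolSum ι (he2.trans (Nat.le_succ 2)) h4₃ χ₈₃,
    ratMinusTwistedSymbolSum_twin_mul_chi4_of_level_eight ι h4₃ h8even h8prim, hpt8] at hv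
  -- the `ℚ₂`-series converges; its image is the interpolation value
  have hS := summable_coeff_mul_pow_of_norm_le hC
    (show ‖(-2 : ℚ_[2])‖ < 1 by
      rw [norm_neg, show (2 : ℚ_[2]) = ((2 : ℕ) : ℚ_[2]) by norm_num, Padic.norm_p]; norm_num)
  have h1 := hS.hasSum.map (algebraMap ℚ_[2] ℂ_[2]) (continuous_algebraMap ℚ_[2] ℂ_[2])
  have hfun : (fun k : ℕ ↦ algebraMap ℚ_[2] ℂ_[2]
      (PowerSeries.coeff k (padicLFunctionMinusBranch f α 1)) * (-2) ^ k) =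
      (algebraMap ℚ_[2] ℂ_[2]) ∘ (fun k : ℕ ↦ PowerSeries.coeff k (padicLFunctionMinusBranch f α 1) *
        (-2) ^ k) := by
    funext k
    simp only [Function.comp_apply, map_mul, map_pow, map_neg, map_ofNat]
  rw [hfun] at hv
  rw [h1.unique hv]
  congr 1
  conv_rhs => rw [← (isQuadratic_χ₈'_ringHomComp).inv]
  exact (coe_symm_ratMinusTwistedSymbolSum_inv ι f _).symm

/-! ### §2 Birch's odd formula for a curve with newform `f′ ⊗ χ₋₈` -/

/-- **Birch's odd formula for `f′ ⊗ χ₋₈`**: `W′/ℚ` elliptic with newform `g′`, `a_n(g′) = χ₋₈(n)·a_n(f′)`, modularity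
continuation `hmod`: `S⁻_{χ₋₈}(f′)·Ω⁻_{f′}·i = τ(χ₋₈)·W′.entireLFunction 1`
(tree `ratMinusTwistedSymbolSum_mul_minusPeriod_mul_I` at the odd primitive `χ₋₈`). [cite: MazurTateTeitelbaum1986Invent, §I.8 (8.6)] -/
theorem ratMinusTwistedSymbolSum_chi8'_mul_minusPeriod_eq (hmod : hasEntireLFunction_rat) {N' M' : ℕ}
    [NeZero N'] [NeZero M'] {f' : CuspForm (Gamma0 N') 2} {g' : CuspForm (Gamma0 M') 2} (hf' : IsNewform0 f')
    (hQ' : coeffField f' = ⊥) (W' : WeierstrassCurve ℚ) [W'.IsElliptic] (hg' : IsNewformOf W' g')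
    (hg'ε : ∀ m : ℕ, cuspCoeff g' m = (ZMod.χ₈'.ringHomComp (Int.castRingHom ℂ)) m * cuspCoeff f' m) :
    haveI : NeZero (2 ^ (2 + 1)) := ⟨by norm_num⟩
    ratMinusTwistedSymbolSum f' (ZMod.χ₈'.ringHomComp (Int.castRingHom ℂ) : DirichletCharacter ℂ (2 ^ (2 + 1))) *
        (minusPeriod f' : ℂ) * Complex.I =
      gaussSum (ZMod.χ₈'.ringHomComp (Int.castRingHom ℂ) : DirichletCharacter ℂ (2 ^ (2 + 1)))
          (ZMod.stdAddChar (N := 2 ^ (2 + 1))) * W'.entireLFunction 1 := by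
  haveI : NeZero (2 ^ (2 + 1)) := ⟨by norm_num⟩
  refine ratMinusTwistedSymbolSum_mul_minusPeriod_mul_I f' hf' hQ' isPrimitive_χ₈'_ringHomComp chi8'_odd
    (W'.differentiable_entireLFunction (hmod W')) (fun s hs ↦ ?_)
  rw [(isQuadratic_χ₈'_ringHomComp).inv]
  exact entireLFunction_eq_twistedLSeries hmod W' hg'
    (ZMod.χ₈'.ringHomComp (Int.castRingHom ℂ) : DirichletCharacter ℂ (2 ^ (2 + 1))) hg'ε hs

/-! ### §3 The companion-free quotient law on the `χ₋₈∘N`-line -/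

variable (ι : PadicAlgCl 2 ≃+* ℂ) (K : Type) [Field K] [NumberField K] [IsGalois ℚ K]

/-- ★★ **THE QUOTIENT LAW on the `χ₋₈∘N`-line, COMPANION-FREE.** Same hypotheses as `quotient_law_chi8'`. Conclusion:
`ι⁻¹(L′(W,1)·Z°·i)·h₂ = σ₀·log₂5·ι⁻¹(ĥ(P)·u·Ω⁻_f·τ(χ₋₈))·ι₂(α⁻³)·L₂⁻′(f,ω,−2)` — `L(W′,1)` has cancelled against the
minus-branch value `L₂⁻(f′,ω,−2) = α⁻³S⁻_{χ₋₈}(f′)` via Birch's odd formula; only `L(W′,1) ≠ 0` was used.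
[cite: Disegni2017, Theorem B (arXiv v3 PDF p. 8)] [cite: MazurTateTeitelbaum1986Invent, §I.8 (8.6), §I.13–I.14] [cite: PerrinRiou1987, §1] -/
theorem quotient_law_chi8'_companion_free (h2 : Module.finrank ℚ K = 2)
    (hsplit : ((Ideal.span {(2 : ℤ)}).primesOver (𝓞 K)).ncard = 2)
    (𝔭 𝔭' : HeightOneSpectrum (𝓞 K)) (h𝔭 : ((2 : ℕ) : 𝓞 K) ∈ 𝔭.asIdeal)
    (h𝔭' : ((2 : ℕ) : 𝓞 K) ∈ 𝔭'.asIdeal)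
    (κ : DirichletCharacter ℂ (NumberField.discr K).natAbs)
    (hκ : ∀ ℓ : ℕ, ℓ.Prime → ℓ ≠ 2 → κ ℓ = (jacobiSym (NumberField.discr K) ℓ : ℂ))
    (hκ2 : κ 2 = if NumberField.discr K % 8 = 1 then 1
        else if NumberField.discr K % 8 = 5 then -1 else 0)
    (hd : Nat.Coprime 2 (NumberField.discr K).natAbs)
    -- the good pair
    (V V' : WeierstrassCurve ℚ) [V.IsElliptic] [V.IsGloballyMinimal] [V'.IsElliptic] [V'.IsGloballyMinimal]
    (hordV : IsOrdinaryAt V 2) (hordV' : IsOrdinaryAt V' 2) (hap : V'.frobeniusTrace 2 = V.frobeniusTrace 2)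
    {N N' : ℕ} [NeZero N] [NeZero N'] {f : CuspForm (Gamma0 N) 2}
    {f' : CuspForm (Gamma0 N') 2} (hfV : IsNewformOf V f) (hfV' : IsNewformOf V' f')
    (hV' : ∀ n : ℕ, cuspCoeff f' n = κ (n : ZMod _) * cuspCoeff f n)
    (h0 : HasSum (fun k : ℕ ↦ PowerSeries.coeff k (padicLFunctionMinusBranch f (unitRoot V 2 : ℚ_[2]) 1) *
      (-2 : ℚ_[2]) ^ k) 0)
    -- the member and its companion (archimedean side)
    (hmod : hasEntireLFunction_rat) {M M' : ℕ} [NeZero M] [NeZero M']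
    {g : CuspForm (Gamma0 M) 2} {g' : CuspForm (Gamma0 M') 2}
    (W W' : WeierstrassCurve ℚ) [W.IsElliptic] [W'.IsElliptic]
    (hg : IsNewformOf W g) (hg' : IsNewformOf W' g')
    (hgε : ∀ m : ℕ, cuspCoeff g m = (ZMod.χ₈'.ringHomComp (Int.castRingHom ℂ)) m * cuspCoeff f m)
    (hg'ε : ∀ m : ℕ, cuspCoeff g' m = (ZMod.χ₈'.ringHomComp (Int.castRingHom ℂ)) m * cuspCoeff f' m)
    (hW1 : W.entireLFunction 1 = 0) (hL : deriv W.entireLFunction 1 ≠ 0) (hL' : W'.entireLFunction 1 ≠ 0)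
    -- the tower frame and the sign character
    {H : Type} [Field H] [NumberField H] [Algebra K H] (hKH : Module.finrank K H = 2) {t : H}
    (htK : t ∉ Set.range (algebraMap K H)) (ht2 : t ^ 2 = algebraMap ℚ H (-2))
    (G : Subgroup (H ≃ₐ[ℚ] H)) (χ : G →* ℂˣ) (s : G → ℤ) (hs : ∀ σ, ((χ σ : ℂˣ) : ℂ) = (s σ : ℂ))
    (τ : H ≃ₐ[ℚ] H) (hτG : τ ∈ G) (hsτ : s ⟨τ, hτG⟩ = -1)
    (hτK : ∀ a : K, τ (algebraMap K H a) = algebraMap K H a) (hτt : τ t = -t)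
    {u : K} {e : ℚ} (hu : u ∉ Set.range (algebraMap ℚ K)) (hue : u ^ 2 = algebraMap ℚ K e)
    (c : K ≃ₐ[ℚ] K) (hcu : c u = -u)
    -- the member's Mordell–Weil data
    [(V.quadraticTwist (-2)).IsElliptic] {P : (V.quadraticTwist (-2)).toAffine.Point}
    (hgen : ∀ R : (V.quadraticTwist (-2)).toAffine.Point,
      ∃ (k : ℤ) (T : (V.quadraticTwist (-2)).toAffine.Point), IsOfFinAddOrder T ∧ R = k • P + T)
    (htors : ∀ Q : ((V.quadraticTwist (-2)).quadraticTwist e).toAffine.Point, IsOfFinAddOrder Q)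
    -- Disegni's datum: invariance, PIN, and the conjoined clauses (PRINT stub of the road)
    (DH : PAdicHeightDataK V 2 H)
    (hDH : ∀ (σ : G) (a b : (V.baseChange H).toAffine.Point),
      DH.pairing (pointGalHom V H σ.1 a) (pointGalHom V H σ.1 b) = DH.pairing a b)
    {h₂ : ℚ_[2]}
    (hpin : DH.pairing
      (twistPointEquivOver V (not_mem_range_rat_of_not_mem_range htK) ht2
        (QuadraticDescent.incl H (V.quadraticTwist (-2)) P))
      (twistPointEquivOver V (not_mem_range_rat_of_not_mem_range htK) ht2
        (QuadraticDescent.incl H (V.quadraticTwist (-2)) P)) = h₂)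
    (hGZ : ChiLineGrossZagierClauses ι K V H f (ι (((unitRoot V 2 : ℚ_[2]) : PadicAlgCl 2)))
      (baseChangeDirichlet K (ZMod.χ₈'.ringHomComp (Int.castRingHom ℂ))) 𝔭 𝔭' G χ DH) :
    ∃ σ₀ : ℤˣ,
      ((ι.symm (deriv W.entireLFunction 1 *
          zCirc (p := 2) (ι (((unitRoot V 2 : ℚ_[2]) : PadicAlgCl 2))) N
            (baseChangeDirichlet K (ZMod.χ₈'.ringHomComp (Int.castRingHom ℂ))) 𝔭 𝔭' * Complex.I) :
          PadicAlgCl 2) : ℂ_[2]) * algebraMap ℚ_[2] ℂ_[2] h₂ =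
      ((σ₀ : ℤ) : ℂ_[2]) * algebraMap ℚ_[2] ℂ_[2] (padicLog 2 (cyclotomicGenerator 2)) *
        ((ι.symm ((canonicalHeight P : ℂ) *
            ((splitLocalConstant 2 : ℂ) * (minusPeriod f : ℂ) *
              gaussSum (ZMod.χ₈'.ringHomComp (Int.castRingHom ℂ) : DirichletCharacter ℂ (2 ^ (2 + 1)))
                (ZMod.stdAddChar (N := 2 ^ (2 + 1))))) : PadicAlgCl 2) : ℂ_[2]) *
        (algebraMap ℚ_[2] ℂ_[2] ((unitRoot V 2 : ℚ_[2])⁻¹ ^ (2 + 1)) *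
          algebraMap ℚ_[2] ℂ_[2] (∑' k : ℕ, PowerSeries.coeff k
              (padicLFunctionMinusBranch f (unitRoot V 2 : ℚ_[2]) 1) * (k : ℚ_[2]) * (-2) ^ (k - 1))) := by
  haveI : NeZero (2 ^ (2 + 1)) := ⟨by norm_num⟩
  obtain ⟨σ₀, hlaw⟩ := quotient_law_chi8' ι K h2 hsplit 𝔭 𝔭' h𝔭 h𝔭' κ hκ hκ2 hd V V' hordV hordV' hap hfV hfV'
    hV' h0 hmod W W' hg hg' hgε hg'ε hW1 hL hL' hKH htK ht2 G χ s hs τ hτG hsτ hτK hτt hu hue c hcu hgen htors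
    DH hDH hpin hGZ
  refine ⟨σ₀, ?_⟩
  set ψ : ℂ →+* ℂ_[2] := (algebraMap (PadicAlgCl 2) ℂ_[2]).comp ι.symm.toRingHom with hψ_def
  have hψ : ∀ z : ℂ, ((ι.symm z : PadicAlgCl 2) : ℂ_[2]) = ψ z := fun z => rfl
  set ι₂ := algebraMap ℚ_[2] ℂ_[2] with hι₂
  -- the companion's value at `−2`
  have hα' : (unitRoot V' 2 : ℚ_[2]) = (unitRoot V 2 : ℚ_[2]) := by
    rw [show unitRoot V' 2 = unitRoot V 2 by unfold unitRoot; rw [hap]]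
  have hval := algebraMap_tsum_coeff_padicLFunctionMinusBranch_neg_two ι hordV' hfV'
  rw [hα', hψ] at hval
  -- Birch (odd) for the companion
  have hf' : IsNewform0 f' := hfV'.1
  have hQ' : coeffField f' = ⊥ := hfV'.coeffField_eq_bot
  have hBirch := ratMinusTwistedSymbolSum_chi8'_mul_minusPeriod_eq hmod hf' hQ' W' hg' hg'ε
  -- non-vanishing
  have hτ : gaussSum (ZMod.χ₈'.ringHomComp (Int.castRingHom ℂ) : DirichletCharacter ℂ (2 ^ (2 + 1)))
      (ZMod.stdAddChar (N := 2 ^ (2 + 1))) ≠ 0 := gaussSum_stdAddChar_ne_zero isPrimitive_χ₈'_ringHomComp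
  have hΩ' : (minusPeriod f' : ℂ) ≠ 0 := by
    exact_mod_cast (IsNewform0.minusPeriod_pos_holds hf' hQ').ne'
  have hI : Complex.I ≠ 0 := Complex.I_ne_zero
  have hS : ratMinusTwistedSymbolSum f'
      (ZMod.χ₈'.ringHomComp (Int.castRingHom ℂ) : DirichletCharacter ℂ (2 ^ (2 + 1))) ≠ 0 := by
    intro h0S
    rw [h0S, zero_mul, zero_mul] at hBirch
    exact (mul_ne_zero hτ hL') hBirch.symm
  have hLW' : W'.entireLFunction 1 =
      ratMinusTwistedSymbolSum f' (ZMod.χ₈'.ringHomComp (Int.castRingHom ℂ) : DirichletCharacter ℂ (2 ^ (2 + 1))) *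
          (minusPeriod f' : ℂ) * Complex.I /
        gaussSum (ZMod.χ₈'.ringHomComp (Int.castRingHom ℂ) : DirichletCharacter ℂ (2 ^ (2 + 1)))
          (ZMod.stdAddChar (N := 2 ^ (2 + 1))) := by
    rw [eq_div_iff hτ]; linear_combination -hBirch
  -- substitute and cancel
  rw [hLW', hval, hψ, hψ] at hlaw
  rw [hψ, hψ]
  have hψS : ψ (ratMinusTwistedSymbolSum f'
      (ZMod.χ₈'.ringHomComp (Int.castRingHom ℂ) : DirichletCharacter ℂ (2 ^ (2 + 1)))) ≠ 0 := (map_ne_zero ψ).mpr hS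
  have hψΩ : ψ (minusPeriod f' : ℂ) ≠ 0 := (map_ne_zero ψ).mpr hΩ'
  have hψτ : ψ (gaussSum (ZMod.χ₈'.ringHomComp (Int.castRingHom ℂ) : DirichletCharacter ℂ (2 ^ (2 + 1)))
      (ZMod.stdAddChar (N := 2 ^ (2 + 1)))) ≠ 0 := (map_ne_zero ψ).mpr hτ
  have hψI : ψ Complex.I ≠ 0 := (map_ne_zero ψ).mpr hI
  simp only [map_mul, map_div₀, map_neg] at hlaw ⊢
  field_simp at hlaw
  field_simp
  linear_combination hlaw

end CompanionMinusEight

end Summit.BirchSwinnertonDyer.BirchSwinnertonDyer.Theorems.PrintCf2.DisegniPairTwo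

end
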